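import Literature.MathematicalPhysics.QuantumFieldTheory.Balaban1983to89.B13NodeTorusWalksAccretive
import Literature.MathematicalPhysics.QuantumFieldTheory.Balaban1983to89.NodeOLettersOfWalksPerturbativeWitness

/-!
# `Balaban1983to89.B13NodeTorusWalksRungWitness` — the RUNG-SIDE HYPOTHESIS BLOCK of
# `b13Leaf_twoTorus_uniformWalksAcross₂` is JOINTLY INHABITED, ∃-closed, across tori with genuine far-ness

statement-level bookkeeping over published theorems with citation tags; kernel-checked compositions of tree theorems and
elementary real arithmetic; nothing here is a claim about the Yang–Mills mass gap.

Cell `pub-ymgap`, D-0062 Track A, node N10 = [Balaban1988RG2Cluster] Lemmas 1–3 (CMP 116); seat `dag-n10-c` (FAN-OUT §N10 s3),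
module 4 — the (A2) companion of `B13NodeTorusWalks` (p451225), `B13NodeTorusWalksAccretive` (p453901) and the Summit-side
junction `BalabanUVNodesN10AtRecord11Walks` (p456133).

WHY.  `B13NodeTorusWalksAccretive.b13Leaf_twoTorus_uniformWalksAcross₂` reads [B13] Lemma 3's per-term kernel inputs
(L17a ∕ L16a) off NODE A's rung `NodeOLettersOfWalksAcross.UniformWalksAcross 𝓣 q`.  Relative to the kernel-level leaf
`B13NodeTorusKernel216.b13Leaf_twoTorus_kernel216` (whose numerics are witnessed in `B13NodeTorusFamilyNonvacuity` ∕
`B13ChainJointNonvacuity`) it ADDS one block of hypotheses, all reading the package `q`: the rung itself, `q.Admissible`,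
`q.PositiveRates`, `q.η ≤ q.etaMax`, `α < q.R`, the round letters `q.Kbar ≤ K_G`, `4∕q.mA ≤ K_Cs`, print's two smallness
sources as thresholds (`α ≤ θ₀R∕(4K̄+4)` — bigger analyticity space, p. 15; `log((4K̄+4)∕θ₀)∕(μ∕4 − κ_C⋆) ≤ R_σ` — σ-cubes far
from `Z₀`, the `O(1)e^{−⅓δ₀M}` of (1.11) p. 5), the rate chain `0 < κ″ < κ′ < κ < κ₂ < q.kapCStar`, the coupling to NODE A's
letter `θ₀ ≤ ϑ`, `hθR1le`, `hsmallKθ`, and `1∕q.mA ≤ cE` inside the (2.24)–(2.25) smallness `hαc`, `hsmall`.  Whether that block is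
jointly satisfiable is not automatic: the thresholds read `K̄`, `μ`, `κ_C⋆` of the SAME package whose accretivity margins must
survive the far-ness `R_σ` and the radius, and the tree's earlier models of the rung sit at `R_σ = 0`.  `dag-n10-b` g6's
`NodeOLettersOfWalksPerturbativeWitness` (p456213) inhabits the rung across tori with ONE volume-uniform package and GENUINE
far-ness (`oneSiteFamily`, `uniformWalksAcross_oneSiteFamily`).  THIS FILE closes the `∃`: for EVERY configuration size `α ≥ 0`,
fibre letter `m`, dimension bound `d_m`, and every model-independent part `B ∈ [0, ½)`, `g_q ≥ 0` of (2.24)–(2.25), ONE package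
is chosen BEFORE the family — ORDER OF CHOICES (no circularity): `μ` large against `(B, g_q)` → rates `ε = κ = 1` →
`η := etaMax` (which does not read `η`) → `K̄, μ-rate, κ_C⋆` → the chain `κ_C⋆∕16 < κ_C⋆∕8 < κ_C⋆∕4 < κ_C⋆∕2` → `ϑ` →
`θ₀` (`B13NodeTorusWalksAccretive.exists_theta_of_vartheta`) → `R₁` large against `α` → `R` → `R_σ` large — and then the whole
block holds, with `UniformWalksAcross` for EVERY family of one-site tori of dimension `≤ d_m` whose site pair is `R_σ`-far (by
`uniformWalksAcross_oneSiteFamily` BY NAME); such tori exist at every size `≥ 2⌈R_σ⌉` (§2).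
* §1 `rungLetters_of_package` — on ANY admissible package with positive rates: the chain below `κ_C⋆`, NODE A's `ϑ` and `θ₀`
  with `hθR1le` (`K_G := q.Kbar`, `K_Cs := 4∕q.mA`), `hsmallKθ`, `2ϑ·m(1+2∕κ″)^ν ≤ δ`, uniformly in `ν ≤ d_m`.  Pure arithmetic.
* §2 far site pairs: on the one-dimensional torus of size `n`, `d₁(0, x) = x` for `2x ≤ n`; hence an `R_σ`-far pair at every
  size `n ≥ 2⌈R_σ⌉`.
* §3 the one-site package's derived constants `Kbar ∕ mu ∕ kapCStar ∕ etaMax ∕ mA` do not read `(R, R_σ, R₁)`, and `etaMax`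
  does not read `η` (`rfl`); positive rates; `0 < etaMax ≤ κ_A`.
* §4 ★ `rungBlock_oneSiteFamily_nonvacuous` — the ∃-closed joint witness, conjunct for conjunct in the binder names of
  `b13Leaf_twoTorus_uniformWalksAcross₂`.

CITATIONS.  [Balaban1988RG2Cluster] T. Bałaban, *Renormalization group approach to lattice gauge field theories. II*,
Comm. Math. Phys. 116 (1988) 1–22: (1.11) p. 5, p. 13, p. 15, (2.16) p. 16, (2.24)–(2.26) p. 17.
[Balaban1985BackgroundPropagators] T. Bałaban, Comm. Math. Phys. 99 (1985) 389–434: Thm 3.10 p. 416.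
[Balaban1984PropagatorsII] T. Bałaban, Comm. Math. Phys. 96 (1984) 223–250: (2.46) p. 231, Lemma 2.1 (2.61) p. 234.

HONEST FRAMING: a degenerate finite-matrix MODEL (n10-b's one-site term) and elementary arithmetic inhabiting a hypothesis
block; NOTHING of Bałaban's operators; count-neutral Track-A side landing; N10 NOT discharged; NOT NODE O for his family; nothing
continuum ∕ ℝ⁴ ∕ OS ∕ mass-gap ∕ Clay.  0 `sorry`, 0 `def`, no instance, no notation; standard axioms.
-/

noncomputable section

namespace Literature.MathematicalPhysics.QuantumFieldTheory.Balaban1983to89.B13NodeTorusWalksRungWitness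

open Metric Set Finset
open Literature.MathematicalPhysics.QuantumFieldTheory.Balaban1983to89
open Literature.MathematicalPhysics.QuantumFieldTheory.Balaban1983to89.B9Thm37GlueTorus (tdist1)
open Literature.MathematicalPhysics.QuantumFieldTheory.Balaban1983to89.B4Sect5Torus (ccoord)
open Literature.MathematicalPhysics.QuantumFieldTheory.Balaban1983to89.B4TorusKernel.MultiPeriod (circAbs circAbs_of_centred)
open Literature.MathematicalPhysics.QuantumFieldTheory.Balaban1983to89.B5TorusCover (UT)
open Literature.MathematicalPhysics.QuantumFieldTheory.Balaban1983to89.B13TermWalkData (TorusTerms)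
open Literature.MathematicalPhysics.QuantumFieldTheory.Balaban1983to89.NodeOLettersOfWalksAcross
  (WalkPackage UniformWalksAcross)
open Literature.MathematicalPhysics.QuantumFieldTheory.Balaban1983to89.NodeOLettersOfWalksPerturbative (RefPackage)
open Literature.MathematicalPhysics.QuantumFieldTheory.Balaban1983to89.NodeOLettersOfWalksPerturbativeWitness
  (oneSitePackage oneSiteFamily uniformWalksAcross_oneSiteFamily admissible_oneSitePackage)
open Literature.MathematicalPhysics.QuantumFieldTheory.Balaban1983to89.B13NodeTorusWalksAccretive
  (exists_theta_of_vartheta)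

/-! ## §1. Letters of a package: the chain below `κ_C⋆`, NODE A's `ϑ`, and `θ₀` — pure arithmetic -/

section Letters

/-- A power factor `m(1 + 2/x)^ν` is non-decreasing in `ν` (`x > 0`). [folklore] -/
private theorem factor_le {m ν dm : ℕ} {x : ℝ} (hx : 0 < x) (hν : ν ≤ dm) :
    (m : ℝ) * (1 + 2 / x) ^ ν ≤ m * (1 + 2 / x) ^ dm :=
  mul_le_mul_of_nonneg_left (pow_le_pow_right₀ (by have := div_pos two_pos hx; linarith) hν) (Nat.cast_nonneg m)

/-- A power factor `m(1 + 2/x)^ν ≥ 0` (`x > 0`). [folklore] -/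
private theorem factor_nonneg {m ν : ℕ} {x : ℝ} (hx : 0 < x) : 0 ≤ (m : ℝ) * (1 + 2 / x) ^ ν :=
  mul_nonneg (Nat.cast_nonneg m) (pow_nonneg (by have := div_pos two_pos hx; linarith) ν)

/-- Monotonicity of the `hθR1le` expression in its four power factors (all letters `≥ 0`). [folklore] -/
private theorem E_mono {a b e f a' b' e' f' t u v : ℝ} (ha : 0 ≤ a) (hb : 0 ≤ b) (he : 0 ≤ e) (hf : 0 ≤ f)
    (haa : a ≤ a') (hbb : b ≤ b') (hee : e ≤ e') (hff : f ≤ f') (ht : 0 ≤ t) (hu : 0 ≤ u) (hv : 0 ≤ v) :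
    a * b * (t * u * v + v * (u * t * e * u * f) * v + v * u * t) ≤
      a' * b' * (t * u * v + v * (u * t * e' * u * f') * v + v * u * t) := by
  have ha' : 0 ≤ a' := ha.trans haa
  have hb' : 0 ≤ b' := hb.trans hbb
  have he' : 0 ≤ e' := he.trans hee
  gcongr

/-- Monotonicity of the `hsmallKθ` expression in its two power factors. [folklore] -/
private theorem S_mono {a b a' b' u t : ℝ} (ha : 0 ≤ a) (hb : 0 ≤ b) (haa : a ≤ a') (hbb : b ≤ b') (ht : 0 ≤ t)
    (hu : 0 ≤ u) : u * a * (t * b) ≤ u * a' * (t * b') :=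
  mul_le_mul (mul_le_mul_of_nonneg_left haa hu) (mul_le_mul_of_nonneg_left hbb ht) (mul_nonneg ht hb)
    (mul_nonneg hu (ha.trans haa))

/-- `t ≤ 1/(A+1)`, `A ≥ 0` ⟹ `tA < 1`. [folklore] -/
private theorem mul_lt_one_of_le {t A : ℝ} (hA : 0 ≤ A) (h : t ≤ 1 / (A + 1)) : t * A < 1 := by
  have h1 : 0 < A + 1 := by linarith
  calc t * A ≤ 1 / (A + 1) * A := mul_le_mul_of_nonneg_right h hA
    _ = A / (A + 1) := by ring
    _ < 1 := by rw [div_lt_one h1]; linarith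

/-- **THE LETTERS OF A PACKAGE — RATE CHAIN, NODE A's `ϑ`, AND `θ₀`.**  For ANY admissible W-walks package `q` with positive
input rates, any fibre letter `m`, dimension bound `d_m` and target `δ > 0`: the chain `κ″ = κ_C⋆∕16 < κ′ = κ_C⋆∕8 < κ = κ_C⋆∕4 <
κ₂ = κ_C⋆∕2 < κ_C⋆` (`κ_C⋆ > 0`, `WalkPackage.kapCStar_spec`), a letter `ϑ > 0` and a `θ₀ ∈ ]0, ϑ]` such that, UNIFORMLY IN THE
MEMBER DIMENSION `ν ≤ d_m`: the letter inequality `hθR1le` of `b13Leaf_twoTorus_uniformWalksAcross₂` at `K_G := q.Kbar`,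
`K_Cs := 4∕q.mA` (linear in `θ₀`: `exists_theta_of_vartheta` at `ν = d_m`, then monotonicity of the power factors in `ν`), the
covariance-factor smallness `hsmallKθ` (`ϑ ≤ 1∕(A+1)`, `A` the factor at `ν = d_m`), and `2ϑ·m(1+2∕κ″)^ν ≤ δ` (room for the
(2.24)–(2.25) smallness).  Pure arithmetic; the order of choices is chain → `ϑ` → `θ₀`.
[cite: Balaban1988RG2Cluster, (1.11) p.5, p.13, p.15, (2.16) p.16, (2.24)–(2.26) p.17] -/
theorem rungLetters_of_package (q : WalkPackage) (hq : q.Admissible) (hp : q.PositiveRates) (m dm : ℕ) {δ : ℝ}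
    (hδ : 0 < δ) :
    ∃ θ₀ ϑ kap kap' kap'' kap₂ : ℝ, 0 < kap'' ∧ kap'' < kap' ∧ kap' < kap ∧ kap < kap₂ ∧ kap₂ < q.kapCStar ∧
      0 < θ₀ ∧ θ₀ ≤ ϑ ∧ 0 < ϑ ∧
      ∀ ν : ℕ, ν ≤ dm →
        (m * (1 + 2 / (kap - kap')) ^ ν) * (m * (1 + 2 / (kap' - kap'')) ^ ν)
            * (θ₀ * (4 / q.mA) * q.Kbar
              + q.Kbar * ((4 / q.mA) * θ₀ * (m * (1 + 2 / (q.kapCStar - kap₂)) ^ ν) * (4 / q.mA)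
                * (m * (1 + 2 / (kap₂ - kap)) ^ ν)) * q.Kbar
              + q.Kbar * (4 / q.mA) * θ₀) ≤ ϑ ∧
        (4 / q.mA) * (m * (1 + 2 / kap) ^ ν) * (ϑ * (m * (1 + 2 / kap'') ^ ν)) < 1 ∧
        2 * (ϑ * (m * (1 + 2 / kap'') ^ ν)) ≤ δ := by
  obtain ⟨hK, -⟩ := WalkPackage.kapCStar_spec hq (WalkPackage.rhoE_pos hp) (WalkPackage.mu_pos hq hp)
  set K := q.kapCStar with hKdef
  have hKG : 0 ≤ q.Kbar := WalkPackage.Kbar_nonneg hq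
  have hKCs : 0 ≤ 4 / q.mA := div_nonneg (by norm_num) hq.hmA.le
  -- the chain `K/16 < K/8 < K/4 < K/2 < K`
  have hd1 : 0 < K / 4 - K / 8 := by linarith
  have hd2 : 0 < K / 8 - K / 16 := by linarith
  have hd3 : 0 < K - K / 2 := by linarith
  have hd4 : 0 < K / 2 - K / 4 := by linarith
  have hk4 : (0 : ℝ) < K / 4 := by linarith
  have hk16 : (0 : ℝ) < K / 16 := by linarith
  -- the largest power factors, at `ν = d_m`
  set X : ℝ := m * (1 + 2 / (K / 4)) ^ dm with hX
  set X'' : ℝ := m * (1 + 2 / (K / 16)) ^ dm with hX''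
  have hX0 : 0 ≤ X := factor_nonneg hk4
  have hX''0 : 0 ≤ X'' := factor_nonneg hk16
  -- NODE A's letter: small against `δ` and against the covariance factor
  set A : ℝ := 4 / q.mA * X * X'' with hA
  have hA0 : 0 ≤ A := mul_nonneg (mul_nonneg hKCs hX0) hX''0
  set ϑ : ℝ := min (δ / (2 * X'' + 1)) (1 / (A + 1)) with hϑ
  have hϑpos : 0 < ϑ := lt_min (div_pos hδ (by linarith)) (div_pos one_pos (by linarith))
  have hϑδ : 2 * (ϑ * X'') ≤ δ := by
    have h1 : ϑ ≤ δ / (2 * X'' + 1) := min_le_left _ _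
    have h2 : ϑ * (2 * X'' + 1) ≤ δ := by rwa [le_div_iff₀ (by linarith)] at h1
    nlinarith
  have hϑA : ϑ * A < 1 := mul_lt_one_of_le hA0 (min_le_right _ _)
  -- `θ₀` from `exists_theta_of_vartheta` at `ν = d_m`
  obtain ⟨θ₀, hθ₀, hθ₀le, hE⟩ := exists_theta_of_vartheta (m := m) (ν := dm) (KG := q.Kbar) (KCs := 4 / q.mA)
    (kap := K / 4) (kap' := K / 8) (kap'' := K / 16) (kap₂ := K / 2) (κC := K) hKG hKCs (by linarith) (by linarith)
    (by linarith) (by linarith) hϑpos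
  refine ⟨θ₀, ϑ, K / 4, K / 8, K / 16, K / 2, hk16, by linarith, by linarith, by linarith, by linarith, hθ₀, hθ₀le,
    hϑpos, fun ν hν => ⟨?_, ?_, ?_⟩⟩
  · -- monotonicity in `ν`, then `hE`
    refine le_trans ?_ hE
    exact E_mono (factor_nonneg hd1) (factor_nonneg hd2) (factor_nonneg hd3) (factor_nonneg hd4) (factor_le hd1 hν)
      (factor_le hd2 hν) (factor_le hd3 hν) (factor_le hd4 hν) hθ₀.le hKCs hKG
  · -- the covariance factor: bounded by `ϑ·A < 1`
    refine lt_of_le_of_lt ?_ hϑA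
    calc 4 / q.mA * (m * (1 + 2 / (K / 4)) ^ ν) * (ϑ * (m * (1 + 2 / (K / 16)) ^ ν))
        ≤ 4 / q.mA * X * (ϑ * X'') :=
          S_mono (factor_nonneg hk4) (factor_nonneg hk16) (factor_le hk4 hν) (factor_le hk16 hν) hϑpos.le hKCs
      _ = ϑ * A := by rw [hA]; ring
  · -- `2ϑ·m(1+2/κ″)^ν ≤ 2ϑ·X″ ≤ δ`
    refine le_trans ?_ hϑδ
    have := factor_le (m := m) hk16 hν
    nlinarith [hϑpos.le]

end Letters

/-! ## §2. Far site pairs exist on every large torus -/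

section Geometry

/-- On the one-dimensional torus `ℤ∕nℤ` the ℓ¹ torus distance from `0` to a centred representative `x` (`2x ≤ n`) is `x` —
the `j = 0` contour length of (2.46). [cite: Balaban1984PropagatorsII, (2.46) p.231] -/
theorem tdist1_fin1_zero (n : ℕ) [NeZero n] (x : Fin n) (hx : 2 * (x : ℕ) ≤ n) :
    tdist1 (fun _ : Fin 1 => n) (UT.ofSite _ fun _ => 0) (UT.ofSite _ fun _ => x) = x := by
  have hn : 1 ≤ n := Nat.one_le_iff_ne_zero.2 (NeZero.ne n)
  unfold tdist1
  rw [Finset.univ_unique, Finset.sum_singleton, UT.toSite_ofSite, UT.toSite_ofSite]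
  unfold ccoord
  have h2 : 2 * |(-(x : ℤ))| ≤ (n : ℤ) := by
    rw [abs_neg, abs_of_nonneg (by positivity)]; exact_mod_cast hx
  rw [Fin.val_zero, Nat.cast_zero, zero_sub, circAbs_of_centred hn h2, abs_neg,
    abs_of_nonneg (by positivity), Int.toNat_natCast]

/-- **FAR SITE PAIRS EXIST AT EVERY SIZE**: the one-dimensional torus of size `n ≥ 2⌈R_σ⌉` carries two sites at ℓ¹ torus
distance `≥ R_σ` (so the families of `rungBlock_oneSiteFamily_nonvacuous` contain tori of every such size).
[cite: Balaban1984PropagatorsII, (2.46) p.231] -/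
theorem exists_far_sites (Rσ : ℝ) (n : ℕ) [NeZero n] (hn : 2 * ⌈Rσ⌉₊ ≤ n) :
    ∃ y₀ x₀ : UT (fun _ : Fin 1 => n), Rσ ≤ tdist1 (fun _ : Fin 1 => n) y₀ x₀ := by
  have hn0 : n ≠ 0 := NeZero.ne n
  have hlt : ⌈Rσ⌉₊ < n := by omega
  refine ⟨UT.ofSite _ fun _ => 0, UT.ofSite _ fun _ => ⟨⌈Rσ⌉₊, hlt⟩, ?_⟩
  rw [tdist1_fin1_zero n ⟨⌈Rσ⌉₊, hlt⟩ (by simpa using hn)]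
  exact Nat.le_ceil Rσ

end Geometry

/-! ## §3. The one-site package: derived constants do not read `(R, R_σ, R₁)`; `etaMax` does not read `η` -/

section OneSite

/-- **THE ONE-SITE PACKAGE's DERIVED CONSTANTS DO NOT READ `(R, R_σ, R₁)`**: `K̄`, the master rate `μ`, `κ_C⋆`, `etaMax`
and `m_A` of `(oneSitePackage μ R ε κ η R_σ d_m).toWalkPackage R₁` are functions of `(μ, ε, κ, η, d_m)` only (`rfl`) — the
non-circularity behind the order of choices «constants first, THEN `R₁` small∕`R` large, THEN `R_σ` large» of
`NodeOLettersOfWalksPerturbative` §6 and of print's two thresholds. [cite: Balaban1988RG2Cluster, p.15, (2.16) p.16] -/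
theorem derived_oneSite_indep (μ R R' ε κ η Rσ Rσ' R₁ R₁' : ℝ) (dm : ℕ) :
    ((oneSitePackage μ R ε κ η Rσ dm).toWalkPackage R₁).Kbar =
        ((oneSitePackage μ R' ε κ η Rσ' dm).toWalkPackage R₁').Kbar ∧
      ((oneSitePackage μ R ε κ η Rσ dm).toWalkPackage R₁).mu =
        ((oneSitePackage μ R' ε κ η Rσ' dm).toWalkPackage R₁').mu ∧
      ((oneSitePackage μ R ε κ η Rσ dm).toWalkPackage R₁).kapCStar =
        ((oneSitePackage μ R' ε κ η Rσ' dm).toWalkPackage R₁').kapCStar ∧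
      ((oneSitePackage μ R ε κ η Rσ dm).toWalkPackage R₁).etaMax =
        ((oneSitePackage μ R' ε κ η Rσ' dm).toWalkPackage R₁').etaMax ∧
      ((oneSitePackage μ R ε κ η Rσ dm).toWalkPackage R₁).mA =
        ((oneSitePackage μ R' ε κ η Rσ' dm).toWalkPackage R₁').mA :=
  ⟨rfl, rfl, rfl, rfl, rfl⟩

/-- `etaMax` of the one-site package does not read `η` (`rfl`): choose `η ≤ etaMax` FIRST, then `c_V := V(η)` — the order of
choices of `WalkPackage.etaMax`. [cite: Balaban1988RG2Cluster, (2.16) p.16] -/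
theorem etaMax_oneSite_indep_eta (μ R ε κ η η' Rσ R₁ : ℝ) (dm : ℕ) :
    ((oneSitePackage μ R ε κ η Rσ dm).toWalkPackage R₁).etaMax =
      ((oneSitePackage μ R ε κ η' Rσ dm).toWalkPackage R₁).etaMax := rfl

/-- The one-site package has positive input rates when `ε, κ > 0`. [cite: Balaban1988RG2Cluster, (2.16) p.16] -/
theorem positiveRates_oneSite {μ R ε κ η Rσ R₁ : ℝ} {dm : ℕ} (hε : 0 < ε) (hκ : 0 < κ) :
    ((oneSitePackage μ R ε κ η Rσ dm).toWalkPackage R₁).PositiveRates :=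
  ⟨hκ, hε, hε, hκ, hε⟩

/-- The admissible ceiling for the volume rate is positive, `0 < etaMax`, on an admissible package with positive input rates
(`μ > 0`, `ρ_E > 0`). [cite: Balaban1988RG2Cluster, (2.16) p.16] -/
theorem etaMax_pos {q : WalkPackage} (hq : q.Admissible) (hp : q.PositiveRates) : 0 < q.etaMax := by
  have hμ := WalkPackage.mu_pos hq hp
  have hρ := WalkPackage.rhoE_pos hp
  unfold WalkPackage.etaMax
  exact lt_min (by linarith) (by linarith)

/-- `etaMax ≤ ρ_E∕2 ≤ κ_A`: the volume rate chosen at the ceiling is a decay rate of the term precision (the reference package's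
`hηA`). [cite: Balaban1988RG2Cluster, (2.16) p.16] -/
theorem etaMax_le_kapA {q : WalkPackage} (hp : q.PositiveRates) : q.etaMax ≤ q.kapA := by
  have hρ := WalkPackage.rhoE_pos hp
  have h1 : q.etaMax ≤ q.rhoE / 2 := min_le_right _ _
  have h2 : q.rhoE ≤ q.kapA := min_le_left _ _
  linarith

end OneSite

/-! ## §4. The rung-side block of `b13Leaf_twoTorus_uniformWalksAcross₂` is jointly inhabited -/

section Main

universe u

/-- ★ **THE RUNG-SIDE BLOCK OF `b13Leaf_twoTorus_uniformWalksAcross₂` IS JOINTLY INHABITED — ∃-CLOSED, ONE PACKAGE BEFORE THE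
FAMILY, GENUINE FAR-NESS.**  For every σ-dimension `d`, base size `N'`, configuration space `E₀`, fibre letter `m`, dimension bound
`d_m`, configuration size `α ≥ 0`, and letters `B ∈ [0, ½)`, `g_q ≥ 0` (the model-independent part
`γ₂ + m′α₄M⁻⁴(1 + 32∕(κ₁−1))⁴` and the form bound of `Γ₀` in (2.24)–(2.25)), there are `μ > 0`, a package
`q = (oneSitePackage μ R ε κ η R_σ d_m).toWalkPackage R₁` and letters `K_G, K_Cs, θ₀, ϑ, κ, κ′, κ″, κ₂, cE` such that — in the
binder names of `B13NodeTorusWalksAccretive.b13Leaf_twoTorus_uniformWalksAcross₂` — `hall` holds for EVERY family of one-site tori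
(`NodeOLettersOfWalksPerturbativeWitness.oneSiteFamily`) of dimension `≤ d_m` whose site pair is `R_σ`-far, tori of every size
`≥ 2⌈R_σ⌉` qualify, and `hq`, `hp`, `hη`, `hαR`, `hKG`, `hKCs`, `hθ₀`, `hαsmall`, `hRσlarge`, `hkap''`, `hk1`–`hk4`, `hθ₀le`,
`hc0`, `hcE` hold, together with `hθR1le`, `hsmallKθ` and the shapes of `hαc`, `hsmall` at every member dimension `ν ≤ d_m`.
ORDER OF CHOICES: `μ := 2 + 2g_q∕(3δ)`, `δ := (½ − B)∕4` → `ε = κ = 1` → `η := etaMax` → `rungLetters_of_package` → `R₁ :=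
α + 1 + α(4K̄+4)∕θ₀` → `R := 8c₀(1,½)^{d_m}R₁ + 8c₀(1,η)^{d_m}R₁ + R₁ + 1` → `R_σ := max(T, log 8c₀(1,½)^{d_m}, log 8c₀(1,η)^{d_m})`,
`T` print's far-ness threshold; `cE := 1∕q.mA = 2∕μ`.  Degenerate model (σ- and `u`-independent one-site kernels); says nothing
about Bałaban's kernels; the two-torus-side binders of the leaf (index data, in-edges (1.24)∕(1.30), NODE A's structural inputs,
constant matching `hvol`, `hΓq`, `hPa`) are NOT addressed here.
[cite: Balaban1988RG2Cluster, (1.11) p.5, p.13, p.15, (2.16) p.16, (2.24)–(2.26) p.17; Balaban1985BackgroundPropagators, Thm 3.10 p.416] -/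
theorem rungBlock_oneSiteFamily_nonvacuous (c : B13.Consts) (d N' : ℕ) (E₀ : Type) [NormedAddCommGroup E₀]
    [NormedSpace ℂ E₀] (m dm : ℕ) {α B gq : ℝ} (hα : 0 ≤ α) (hB : 0 ≤ B) (hB2 : B < 1 / 2) (hgq : 0 ≤ gq) :
    ∃ (μ : ℝ) (hμ : 0 < μ) (R ε κ η Rσ R₁ : ℝ) (q : WalkPackage) (KG KCs θ₀ ϑ kap kap' kap'' kap₂ cE : ℝ),
      q = (oneSitePackage μ R ε κ η Rσ dm).toWalkPackage R₁ ∧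
      -- `hall`: the rung across EVERY family of one-site tori of dimension `≤ d_m` with `R_σ`-far site pairs
      (∀ {S : Type u} (νs : S → ℕ) (Nfs : (s : S) → Fin (νs s) → ℕ) [∀ s i, NeZero (Nfs s i)]
          (y₀ x₀ : (s : S) → UT (Nfs s)), (∀ s, νs s ≤ dm) → (∀ s, Rσ ≤ tdist1 (Nfs s) (y₀ s) (x₀ s)) →
          UniformWalksAcross (oneSiteFamily (d := d) c N' E₀ νs Nfs y₀ x₀ hμ) q) ∧
      -- such members exist at every torus size `n ≥ 2⌈R_σ⌉` (dimension one)
      (∀ n : ℕ, [NeZero n] → 2 * ⌈Rσ⌉₊ ≤ n →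
          ∃ y₀ x₀ : UT (fun _ : Fin 1 => n), Rσ ≤ tdist1 (fun _ : Fin 1 => n) y₀ x₀) ∧
      -- `hq`, `hp`, `hη`
      q.Admissible ∧ q.PositiveRates ∧ q.η ≤ q.etaMax ∧
      -- `hαR`, `hKG`, `hKCs`, `hθ₀`, `hαsmall`, `hRσlarge`
      α < q.R ∧ q.Kbar ≤ KG ∧ 4 / q.mA ≤ KCs ∧ 0 < θ₀ ∧ α ≤ θ₀ * q.R / (4 * q.Kbar + 4) ∧
      Real.log ((4 * q.Kbar + 4) / θ₀) / (q.mu / 4 - q.kapCStar) ≤ q.Rσ ∧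
      -- `hkap''`, `hk1`–`hk4`, `hθ₀le`
      0 < kap'' ∧ kap'' < kap' ∧ kap' < kap ∧ kap < kap₂ ∧ kap₂ < q.kapCStar ∧ θ₀ ≤ ϑ ∧
      -- `hc0`, `hcE`
      0 ≤ cE ∧ 1 / q.mA ≤ cE ∧
      -- `hθR1le`, `hsmallKθ`, and the shapes of `hαc`, `hsmall`, at every member dimension `ν ≤ d_m`
      (∀ ν : ℕ, ν ≤ dm →
        (m * (1 + 2 / (kap - kap')) ^ ν) * (m * (1 + 2 / (kap' - kap'')) ^ ν)
            * (θ₀ * KCs * KG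
              + KG * (KCs * θ₀ * (m * (1 + 2 / (q.kapCStar - kap₂)) ^ ν) * KCs
                * (m * (1 + 2 / (kap₂ - kap)) ^ ν)) * KG
              + KG * KCs * θ₀) ≤ ϑ ∧
        KCs * (m * (1 + 2 / kap) ^ ν) * (ϑ * (m * (1 + 2 / kap'') ^ ν)) < 1 ∧
        (2 * (ϑ * (m * (1 + 2 / kap'') ^ ν)) + B) * cE ≤ 1 / 2 ∧
        (2 * (ϑ * (m * (1 + 2 / kap'') ^ ν)) + B) * (1 + 2 * cE * gq) ≤ 1 / 2) := by
  -- ORDER OF CHOICES. (1) `δ`, and `μ` LARGE against `B`, `g_q` (so that `cE = 1/m_A = 2/μ` is small)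
  set δ : ℝ := (1 / 2 - B) / 4 with hδdef
  have hδ : 0 < δ := by rw [hδdef]; linarith
  set μ : ℝ := 2 + 2 * gq / (3 * δ) with hμdef
  have hμ2 : 2 ≤ μ := by
    rw [hμdef]
    have := div_nonneg (by linarith : 0 ≤ 2 * gq) (by linarith : (0:ℝ) ≤ 3 * δ)
    linarith
  have hμ : 0 < μ := by linarith
  have hμgq : 2 * gq ≤ 3 * δ * μ := by
    have e : 3 * δ * μ = 6 * δ + 2 * gq := by
      rw [hμdef]; field_simp; ring
    rw [e]; linarith
  -- (2) rates `ε = κ = 1`; the admissible ceiling `etaMax` (does not read `η`), and `η := etaMax`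
  set q₀ : WalkPackage := (oneSitePackage μ 1 1 1 1 0 dm).toWalkPackage 1 with hq₀def
  have hq₀ : q₀.Admissible :=
    RefPackage.admissible_toWalkPackage (admissible_oneSitePackage hμ one_pos zero_le_one one_pos one_pos le_rfl)
      one_pos
  have hp₀ : q₀.PositiveRates := positiveRates_oneSite one_pos one_pos
  set ηs : ℝ := q₀.etaMax with hηsdef
  have hηs : 0 < ηs := etaMax_pos hq₀ hp₀
  have hηs1 : ηs ≤ 1 := etaMax_le_kapA hp₀
  set q₁ : WalkPackage := (oneSitePackage μ 1 1 1 ηs 0 dm).toWalkPackage 1 with hq₁def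
  have hq₁ : q₁.Admissible :=
    RefPackage.admissible_toWalkPackage (admissible_oneSitePackage hμ one_pos zero_le_one one_pos hηs hηs1) one_pos
  have hp₁ : q₁.PositiveRates := positiveRates_oneSite one_pos one_pos
  -- (3) the letters: chain below `κ_C⋆`, `ϑ`, `θ₀`
  obtain ⟨θ₀, ϑ, kap, kap', kap'', kap₂, hk0, hk1, hk2, hk3, hk4, hθ₀, hθ₀le, hϑ, hL⟩ :=
    rungLetters_of_package q₁ hq₁ hp₁ m dm hδ
  have hKbar : 0 ≤ q₁.Kbar := WalkPackage.Kbar_nonneg hq₁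
  -- (4) the accretivity radius `R₁` LARGE against `α` (print's bigger analyticity space)
  set R₁ : ℝ := α + 1 + α * (4 * q₁.Kbar + 4) / θ₀ with hR₁def
  have h44 : 0 < 4 * q₁.Kbar + 4 := by linarith
  have hR₁α : α < R₁ := by
    rw [hR₁def]; have := div_nonneg (mul_nonneg hα h44.le) hθ₀.le; linarith
  have hR₁ : 0 < R₁ := lt_of_le_of_lt hα hR₁α
  have hαsmall : α ≤ θ₀ * R₁ / (4 * q₁.Kbar + 4) := by
    rw [le_div_iff₀ h44, hR₁def]
    have e : θ₀ * (α + 1 + α * (4 * q₁.Kbar + 4) / θ₀) = θ₀ * (α + 1) + α * (4 * q₁.Kbar + 4) := by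
      field_simp
    rw [e]; nlinarith
  -- (5) the analyticity radius `R` against the two `R₁`-thresholds
  set c₁ : ℝ := B6.c0 1 (1 / 2) ^ dm with hc₁def
  set c₂ : ℝ := B6.c0 1 ηs ^ dm with hc₂def
  have hc₁ : 1 ≤ c₁ := one_le_pow₀ (B6Lemma21Arith.one_le_c0 (by norm_num))
  have hc₂ : 1 ≤ c₂ := one_le_pow₀ (B6Lemma21Arith.one_le_c0 (by simpa using hηs))
  set R : ℝ := 8 * c₁ * R₁ + 8 * c₂ * R₁ + R₁ + 1 with hRdef
  have h8₁ : 0 ≤ 8 * c₁ * R₁ := by positivity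
  have h8₂ : 0 ≤ 8 * c₂ * R₁ := by positivity
  have hR : 0 < R := by rw [hRdef]; linarith
  have hR₁R : R₁ < R := by rw [hRdef]; linarith
  have h₁₀ : 8 * B6.c0 1 (1 / 2) ^ dm * R₁ ≤ R := by rw [hRdef]; linarith
  have h₁ : 8 * B6.c0 1 ηs ^ dm * R₁ ≤ R := by rw [hRdef]; linarith
  -- (6) the far-ness `R_σ` LARGE: print's threshold and the two `e^{−εR_σ}`-thresholds
  set T : ℝ := Real.log ((4 * q₁.Kbar + 4) / θ₀) / (q₁.mu / 4 - q₁.kapCStar) with hTdef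
  set Rσ : ℝ := max T (max (Real.log (8 * c₁)) (Real.log (8 * c₂))) with hRσdef
  have hexp : ∀ {x : ℝ}, 1 ≤ x → Real.log (8 * x) ≤ Rσ → 8 * x * Real.exp (-(1 * Rσ)) ≤ 1 := by
    intro x hx hle
    have h8 : 0 < 8 * x := by linarith
    have h2 : Real.exp (-(1 * Rσ)) ≤ (8 * x)⁻¹ := by
      rw [one_mul, Real.exp_neg, ← Real.exp_log h8]
      exact inv_anti₀ (Real.exp_pos _) (Real.exp_le_exp.2 hle)
    calc 8 * x * Real.exp (-(1 * Rσ)) ≤ 8 * x * (8 * x)⁻¹ := mul_le_mul_of_nonneg_left h2 h8.le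
      _ = 1 := mul_inv_cancel₀ h8.ne'
  have hσ₀ : 8 * B6.c0 1 (1 / 2) ^ dm * Real.exp (-(1 * Rσ)) ≤ 1 :=
    hexp hc₁ ((le_max_left _ _).trans (le_max_right _ _))
  have hσ : 8 * B6.c0 1 ηs ^ dm * Real.exp (-(1 * Rσ)) ≤ 1 :=
    hexp hc₂ ((le_max_right _ _).trans (le_max_right _ _))
  -- (7) the package, and its derived constants = those of `q₁`
  set q : WalkPackage := (oneSitePackage μ R 1 1 ηs Rσ dm).toWalkPackage R₁ with hqdef
  obtain ⟨eK, eμ, eC, eE, eA⟩ := derived_oneSite_indep μ R 1 1 1 ηs Rσ 0 R₁ 1 dm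
  have hmA : 0 < q.mA := by show 0 < μ / 2; linarith
  have hcE : 1 / q.mA = 2 / μ := by show 1 / (μ / 2) = 2 / μ; rw [one_div_div]
  have hcE1 : 2 / μ ≤ 1 := by rw [div_le_one hμ]; exact hμ2
  have hcEgq : 2 / μ * gq ≤ 3 * δ := by
    rw [div_mul_eq_mul_div, div_le_iff₀ hμ]; linarith
  refine ⟨μ, hμ, R, 1, 1, ηs, Rσ, R₁, q, q.Kbar, 4 / q.mA, θ₀, ϑ, kap, kap', kap'', kap₂, 1 / q.mA, rfl, ?_,
    fun n _ hn => exists_far_sites Rσ n hn,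
    RefPackage.admissible_toWalkPackage (admissible_oneSitePackage hμ hR zero_le_one one_pos hηs hηs1) hR₁,
    positiveRates_oneSite one_pos one_pos, ?_, hR₁α, le_rfl, le_rfl, hθ₀, ?_, ?_, hk0, hk1, hk2, hk3, ?_, hθ₀le,
    (div_nonneg zero_le_one hmA.le), le_rfl, fun ν hν => ?_⟩
  · -- `hall`
    intro S νs Nfs _ y₀ x₀ hν hfar
    exact uniformWalksAcross_oneSiteFamily c N' E₀ hμ hR zero_le_one one_pos hηs hηs1 hfar hν hR₁ hR₁R hσ₀ h₁₀ hσ h₁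
  · -- `hη`
    show ηs ≤ q.etaMax
    rw [eE]; exact le_of_eq (etaMax_oneSite_indep_eta μ 1 1 1 1 ηs 0 1 dm)
  · -- `hαsmall`
    show α ≤ θ₀ * R₁ / (4 * q.Kbar + 4)
    rw [eK]; exact hαsmall
  · -- `hRσlarge`
    show Real.log ((4 * q.Kbar + 4) / θ₀) / (q.mu / 4 - q.kapCStar) ≤ Rσ
    rw [eK, eμ, eC]; exact le_max_left _ _
  · -- `hk4`
    rw [eC]; exact hk4
  · -- the four inequalities at `ν ≤ d_m`
    obtain ⟨hE, hS, hδν⟩ := hL ν hν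
    rw [hcE, eK, eA, eC]
    have hP : 0 ≤ 2 * (ϑ * (m * (1 + 2 / kap'') ^ ν)) :=
      mul_nonneg zero_le_two (mul_nonneg hϑ.le (factor_nonneg hk0))
    have hSB : 2 * (ϑ * (m * (1 + 2 / kap'') ^ ν)) + B ≤ 1 / 2 - 3 * δ := by rw [hδdef] at hδν ⊢; linarith
    refine ⟨hE, hS, ?_, ?_⟩
    · calc (2 * (ϑ * (m * (1 + 2 / kap'') ^ ν)) + B) * (2 / μ)
          ≤ (2 * (ϑ * (m * (1 + 2 / kap'') ^ ν)) + B) * 1 :=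
            mul_le_mul_of_nonneg_left hcE1 (by linarith)
        _ ≤ 1 / 2 := by linarith
    · have hge : 0 ≤ 2 / μ * gq := mul_nonneg (div_nonneg zero_le_two hμ.le) hgq
      calc (2 * (ϑ * (m * (1 + 2 / kap'') ^ ν)) + B) * (1 + 2 * (2 / μ) * gq)
          = (2 * (ϑ * (m * (1 + 2 / kap'') ^ ν)) + B)
            + (2 * (ϑ * (m * (1 + 2 / kap'') ^ ν)) + B) * (2 * (2 / μ * gq)) := by ring
        _ ≤ (1 / 2 - 3 * δ) + (1 / 2) * (2 * (2 / μ * gq)) := by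
            gcongr
            linarith
        _ = (1 / 2 - 3 * δ) + 2 / μ * gq := by ring
        _ ≤ 1 / 2 := by linarith

end Main


end Literature.MathematicalPhysics.QuantumFieldTheory.Balaban1983to89.B13NodeTorusWalksRungWitness

end
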